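import Summits.AnomalousDissipation.AnomalousDissipation.Theses.TaylorCertificates
import Summits.AnomalousDissipation.AnomalousDissipation.Theorems.TaylorCertificatePair.Negative.Bounds
import Literature.Analysis.FunctionSpaces.TorusFluidGlueProofs

/-!
# Sketch — crux-ideate stmt-AnomalousDissipation-14030 (`TaylorCertificates.KolmogorovFloor`), round 1, ideator 1 (gen 2)

Typed companions of the crux idea card `truncated-euler-k41-hot` (this seat, gen 2):

* `IsTruncatedEulerSteady N' f a` — an EXACT steady state of the level-`N'` Galerkin–Euler system of `f`
  ("truncated dodger"): a smooth div-free mean-zero trigonometric polynomial `a`, `P_{N'} a = a`, with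
  `P_{N'} P[(a·∇)a] = P_{N'} f`, written as `∫ ⟪(a·∇)a − f, w⟫ = 0` for every smooth div-free mean-zero
  test field `w` with `P_{N'} w = w`.
* FIRST LEMMA `floor_terms_at_truncatedEulerSteady` (PROVED): at such a state, for every cylindrical
  `Φ₁` whose differential `W = Φ₁'(u)` is band-limited at level `N'` (e.g. test fields of degree
  `N ≤ N'`), the injection and the inertial term of the Navier–Stokes generator CANCEL EXACTLY and the
  force does no work:  `⟨F_ν(u), W⟩ = ν (a, ΔW)`  and  `(u, f) = 0`.  Hence (`floor_at_truncatedEulerSteady`,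
  PROVED) the crux's floor functional at `a` is `(1 − 2θ₁)·ν‖∇a‖² + ν(a, ΔW)`: the certificate is blind to
  inertia and force at a truncated dodger and can pay the floor only through the VISCOUS DRIFT.
* `DodgerRoughness f κ` — the card's necessary condition (K41/Onsager floor on the enstrophy of truncated
  dodgers), `CheapDodgerFamily f` — the adversary statement, and the paper theorems of the card as Props:
  `FloorWitnessForcesDodgerRoughness` (KolmogorovFloor-witness ⇒ dodgers are K41-rough, via the filed
  support `PacketLemma`, stmt-14032) and `cheapDodgers_kill` (sub-Onsager dodger families for every force
  ⇒ ¬KolmogorovFloor).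
-/

noncomputable section

set_option linter.dupNamespace false

open MeasureTheory UnitAddTorus
open scoped InnerProductSpace ENNReal

namespace Summit.AnomalousDissipation.AnomalousDissipation.Cruxes.KolmogorovFloor.Ideate1G2

open Literature.Analysis.FunctionSpaces Literature.Analysis.FluidPDE
open Summit.AnomalousDissipation.AnomalousDissipation.Theses.TaylorCertificates
open Summit.AnomalousDissipation.AnomalousDissipation.Theorems.TaylorCertificatePair.Negative

local notation "𝕋³" => UnitAddTorus (Fin 3)
local notation "E³" => EuclideanSpace ℝ (Fin 3)
local notation "HH" => Literature.Analysis.FunctionSpaces.Torus.energySpace (Fin 3)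
local notation "L2T" => MeasureTheory.Lp (EuclideanSpace ℝ (Fin 3)) 2
  (MeasureTheory.volume : MeasureTheory.Measure (UnitAddTorus (Fin 3)))

/-! ### Truncated dodgers -/

/-- A TRUNCATED DODGER of `f` at level `N'`: an exact steady state of the Galerkin–Euler system
`P_{N'} P[(a·∇)a] = P_{N'} f` — a smooth divergence-free mean-zero trigonometric polynomial of degree
`≤ N'` whose Euler residual `(a·∇)a − f` is orthogonal to every smooth divergence-free mean-zero field of
degree `≤ N'` (the resolved Leray-projected residual vanishes; the unresolved part is unconstrained). -/
def IsTruncatedEulerSteady (N' : ℕ) (f a : 𝕋³ → E³) : Prop :=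
  Torus.IsSmooth a ∧ Torus.IsDivFree a ∧ Torus.HasZeroMean a ∧ Torus.fourierTruncate N' a = a ∧
    ∀ w : 𝕋³ → E³, Torus.IsSmooth w → Torus.IsDivFree w → Torus.HasZeroMean w →
      Torus.fourierTruncate N' w = w → ∫ x, ⟪Torus.convect a a x - f x, w x⟫_ℝ = 0

/-! ### FIRST LEMMA: at a truncated dodger the generator reduces to the viscous drift -/

/-- FIRST LEMMA (card `truncated-euler-k41-hot`). Let `a` be a truncated dodger of `f` at level `N'`,
`u ∈ H` the state it represents, and `Φ₁` a cylindrical functional whose differential `W = Φ₁'(u)` is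
band-limited at level `N'`. Then the injection `(f, W)` and the inertial term `∫(a⊗a):∇W = −((a·∇)a, W)`
cancel exactly, `⟨F_ν(u), W⟩ = ν (a, ΔW)`, and the force does no work on the state, `(u, f) = 0`
(test the truncated Euler equation with `W`, resp. with `a` itself, and use `((a·∇)a, a) = 0`). -/
theorem floor_terms_at_truncatedEulerSteady {N' : ℕ} {f a : 𝕋³ → E³} (hf : Torus.IsSmooth f)
    (ha : IsTruncatedEulerSteady N' f a) {u : HH} (hu : ((u : L2T) : 𝕋³ → E³) =ᵐ[volume] a)
    (Φ₁ : Torus.CylindricalTest (Fin 3))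
    (hW : Torus.fourierTruncate N' (Φ₁.grad u) = Φ₁.grad u) (ν : ℝ) :
    Torus.nsGeneratorPairing ν f u (Φ₁.grad u) = ν * ∫ x, ⟪a x, Torus.laplacian (Φ₁.grad u) x⟫_ℝ ∧
      Torus.pairing (u : L2T) f = 0 := by
  obtain ⟨has, had, haz, _hab, hsteady⟩ := ha
  have hWs : Torus.IsSmooth (Φ₁.grad u) := isSmooth_grad Φ₁ u
  constructor
  · rw [nsGeneratorPairing_of_ae hu]
    have h1 : ∫ x, ⟪Torus.fderiv (Φ₁.grad u) x (a x), a x⟫_ℝ = -∫ x, ⟪f x, Φ₁.grad u x⟫_ℝ := by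
      have e1 : (fun x => ⟪Torus.fderiv (Φ₁.grad u) x (a x), a x⟫_ℝ) =
          fun x => ⟪Torus.convect a (Φ₁.grad u) x, a x⟫_ℝ := rfl
      rw [e1, Torus.integral_inner_convect_eq_neg has had hWs has]
      have e2 := hsteady (Φ₁.grad u) hWs (isDivFree_grad Φ₁ u) (hasZeroMean_grad Φ₁ u) hW
      have hint1 : Integrable (fun x => ⟪Torus.convect a a x, Φ₁.grad u x⟫_ℝ) volume :=
        ((has.convect has).inner hWs).integrable
      have hint2 : Integrable (fun x => ⟪f x, Φ₁.grad u x⟫_ℝ) volume := (hf.inner hWs).integrable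
      have e3 : ∫ x, ⟪Torus.convect a a x - f x, Φ₁.grad u x⟫_ℝ =
          (∫ x, ⟪Torus.convect a a x, Φ₁.grad u x⟫_ℝ) - ∫ x, ⟪f x, Φ₁.grad u x⟫_ℝ := by
        simp_rw [inner_sub_left]
        exact integral_sub hint1 hint2
      have e4 : ∫ x, ⟪Φ₁.grad u x, Torus.convect a a x⟫_ℝ = ∫ x, ⟪Torus.convect a a x, Φ₁.grad u x⟫_ℝ :=
        integral_congr_ae (ae_of_all _ fun x => real_inner_comm _ _)
      rw [e4]
      linarith
    rw [h1]
    ring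
  · rw [pairing_of_ae hu]
    have e2 := hsteady a has had haz _hab
    have hself : ∫ x, ⟪Torus.convect a a x, a x⟫_ℝ = 0 := Torus.integral_inner_convect_self_eq_zero has had
    have hint1 : Integrable (fun x => ⟪Torus.convect a a x, a x⟫_ℝ) volume :=
      ((has.convect has).inner has).integrable
    have hint2 : Integrable (fun x => ⟪f x, a x⟫_ℝ) volume := (hf.inner has).integrable
    have e3 : ∫ x, ⟪Torus.convect a a x - f x, a x⟫_ℝ =
        (∫ x, ⟪Torus.convect a a x, a x⟫_ℝ) - ∫ x, ⟪f x, a x⟫_ℝ := by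
      simp_rw [inner_sub_left]
      exact integral_sub hint1 hint2
    have e5 : ∫ x, ⟪a x, f x⟫_ℝ = ∫ x, ⟪f x, a x⟫_ℝ :=
      integral_congr_ae (ae_of_all _ fun x => real_inner_comm _ _)
    rw [e5]
    linarith

/-- Viscous dissipation `D(u) = ν‖∇u‖²` of a state (spectral; as in the route decl). -/
def dissip (ν : ℝ) (u : HH) : ℝ := ν * (Torus.eGradNormSq (((u : L2T) : 𝕋³ → E³))).toReal

/-- COROLLARY (PROVED): the crux's floor functional at a truncated dodger. With `W = Φ₁'(u)` band-limited
at the dodger's level, `D + ⟨F_ν(u), W⟩ + 2θ₁((u,f) − D) = (1 − 2θ₁) D + ν (a, ΔW)`: the certificate sees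
NOTHING of inertia or force and must pay the floor `ε₀` through the viscous drift `ν(a, ΔW) = −ν(∇a, ∇W)`
(or through the state's own dissipation). -/
theorem floor_at_truncatedEulerSteady {N' : ℕ} {f a : 𝕋³ → E³} (hf : Torus.IsSmooth f)
    (ha : IsTruncatedEulerSteady N' f a) {u : HH} (hu : ((u : L2T) : 𝕋³ → E³) =ᵐ[volume] a)
    (Φ₁ : Torus.CylindricalTest (Fin 3))
    (hW : Torus.fourierTruncate N' (Φ₁.grad u) = Φ₁.grad u) (ν θ₁ : ℝ) :
    dissip ν u + Torus.nsGeneratorPairing ν f u (Φ₁.grad u) + 2 * θ₁ * (Torus.pairing (u : L2T) f - dissip ν u) =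
      (1 - 2 * θ₁) * dissip ν u + ν * ∫ x, ⟪a x, Torus.laplacian (Φ₁.grad u) x⟫_ℝ := by
  obtain ⟨hgen, hwork⟩ := floor_terms_at_truncatedEulerSteady hf ha hu Φ₁ hW ν
  rw [hgen, hwork]
  ring

/-! ### The necessary condition and the adversary, as Props -/

/-- The witness form of the crux for a GIVEN force and constants (verbatim the inner block of
`KolmogorovFloor`; `KolmogorovFloor ↔ ∃ f …, FloorWitness f ε₀ C Θ ν₀` is `Iff.rfl`, below). -/
def FloorWitness (f : 𝕋³ → E³) (ε₀ C Θ ν₀ : ℝ) : Prop :=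
  0 < ε₀ ∧ 0 < ν₀ ∧ ∀ ν : ℝ, 0 < ν → ν < ν₀ → ∃ (N : ℕ) (Φ₁ : Literature.Analysis.FluidPDE.Torus.CylindricalTest (Fin 3)) (θ₁ : ℝ), (N : ℝ) ≤ C * ν ^ (-(3 / 4 : ℝ)) ∧ (∀ i, Literature.Analysis.FunctionSpaces.Torus.fourierTruncate N (Φ₁.g i) = Φ₁.g i) ∧ -Θ ≤ θ₁ ∧ θ₁ ≤ 0 ∧ ∀ u : Literature.Analysis.FunctionSpaces.Torus.energySpace (Fin 3), let uf : UnitAddTorus (Fin 3) → EuclideanSpace ℝ (Fin 3) := ((u : MeasureTheory.Lp (EuclideanSpace ℝ (Fin 3)) 2 (MeasureTheory.volume : MeasureTheory.Measure (UnitAddTorus (Fin 3)))) : UnitAddTorus (Fin 3) → EuclideanSpace ℝ (Fin 3)); let D : ℝ := ν * (Literature.Analysis.FunctionSpaces.Torus.eGradNormSq uf).toReal; let P : ℝ := Literature.Analysis.FluidPDE.Torus.pairing (u : MeasureTheory.Lp (EuclideanSpace ℝ (Fin 3)) 2 (MeasureTheory.volume : MeasureTheory.Measure (UnitAddTorus (Fin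 3)))) f - D; Literature.Analysis.FunctionSpaces.Torus.eGradNormSq uf ≠ ⊤ → ‖u‖ ^ 2 ≤ 16 * (∫ x, ‖f x‖ ^ 2) / ν ^ 2 → ε₀ ≤ D + Literature.Analysis.FluidPDE.Torus.nsGeneratorPairing ν f u (Φ₁.grad u) + 2 * θ₁ * P

/-- The crux is its witness form, definitionally. -/
theorem kolmogorovFloor_iff_witness :
    KolmogorovFloor ↔ ∃ f : 𝕋³ → E³, Torus.IsSmooth f ∧ Torus.IsDivFree f ∧ Torus.HasZeroMean f ∧
      ∃ (ε₀ C Θ ν₀ : ℝ), FloorWitness f ε₀ C Θ ν₀ := Iff.rfl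

/-- DODGER ROUGHNESS of `f` with constant `κ` (the card's necessary condition): beyond some level, every
truncated dodger of `f` of energy `≤ E` is at least K41-rough, `‖∇a‖₂ ≥ κ · N'^{2/3}` — the Onsager /
Kolmogorov exponent: `ν‖∇a‖² ≥ κ² C^{4/3}` at the matched Kolmogorov viscosity `ν = (C/N')^{4/3}`. -/
def DodgerRoughness (f : 𝕋³ → E³) (κ : ℝ) : Prop :=
  ∀ E : ℝ, ∃ N₀ : ℕ, ∀ N' : ℕ, N₀ ≤ N' → ∀ a : 𝕋³ → E³, IsTruncatedEulerSteady N' f a →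
    ∫ x, ‖a x‖ ^ 2 ≤ E → κ * (N' : ℝ) ^ (2 / 3 : ℝ) ≤ Real.sqrt (Torus.gradNormSq a)

/-- The ADVERSARY: `f` admits a bounded-energy family of SUB-ONSAGER (cheaper than K41) truncated dodgers
along infinitely many levels — `‖∇a_{N'}‖₂ = o(N'^{2/3})`. -/
def CheapDodgerFamily (f : 𝕋³ → E³) : Prop :=
  ∃ E : ℝ, ∀ κ : ℝ, 0 < κ → ∀ N₀ : ℕ, ∃ N' : ℕ, N₀ ≤ N' ∧ ∃ a : 𝕋³ → E³, IsTruncatedEulerSteady N' f a ∧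
    ∫ x, ‖a x‖ ^ 2 ≤ E ∧ Real.sqrt (Torus.gradNormSq a) ≤ κ * (N' : ℝ) ^ (2 / 3 : ℝ)

/-- `CheapDodgerFamily f` is the negation-shape of `DodgerRoughness f κ` for every `κ > 0` (logic). -/
theorem not_dodgerRoughness_of_cheap {f : 𝕋³ → E³} (h : CheapDodgerFamily f) {κ : ℝ} (hκ : 0 < κ) :
    ¬ DodgerRoughness f (2 * κ) := by
  intro hR
  obtain ⟨E, hE⟩ := h
  obtain ⟨N₀, hN₀⟩ := hR E
  obtain ⟨N', hN', a, ha, haE, hcheap⟩ := hE κ hκ (max N₀ 1)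
  have hle := hN₀ N' (le_trans (le_max_left _ _) hN') a ha haE
  have hN'pos : (1 : ℝ) ≤ (N' : ℝ) := by
    have : 1 ≤ N' := le_trans (le_max_right _ _) hN'
    exact_mod_cast this
  have hpow : 0 < (N' : ℝ) ^ (2 / 3 : ℝ) := Real.rpow_pos_of_pos (by linarith) _
  nlinarith

/-- PAPER THEOREM of the card (Lean size M given the support `PacketLemma`, stmt-14032): a floor witness
forces dodger roughness with the explicit constant
`κ_* = min{ (ε₀/(2(1+2Θ)C^{4/3}))^{1/2}, ε₀/(128π²(1+2Θ)K₁²C^{8/3}) }`.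
Proof (card §Lever/§Why): at a dodger `a` of level `N' = ⌊Cν^{-3/4}⌋` the floor functional is
`(1+2|θ₁|)ν‖∇a‖² − ν(∇a,∇W)` (first lemma); either the strain `s = sup‖e(W)‖_op` of `W = Φ₁'(a)` exceeds
`s_A = 32π²(1+2Θ)K₁²νN'²` and a coords-invisible packet above `2N'` riding the most compressive direction of
`e(W)` drives the floor to `−∞` inside the Leray ball, or `s < s_A` and Korn (`‖∇W‖₂ = √2‖e(W)‖₂ ≤ 2s`)
gives `FLOOR(a) ≤ (1+2Θ)C^{4/3}κ² + 128π²(1+2Θ)K₁²C^{8/3}κ < ε₀` for `κ < κ_*`. -/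
def FloorWitnessForcesDodgerRoughness : Prop :=
  PacketLemma → ∀ (f : 𝕋³ → E³) (ε₀ C Θ ν₀ : ℝ), Torus.IsSmooth f → Torus.IsDivFree f → Torus.HasZeroMean f →
    FloorWitness f ε₀ C Θ ν₀ → ∃ κ : ℝ, 0 < κ ∧ DodgerRoughness f κ

/-- The kill form: sub-Onsager dodger families for EVERY smooth div-free mean-zero force refute the crux
(for every choice of `ε₀, C, Θ`). Per force: `CheapDodgerFamily f → ¬ FloorWitness f ε₀ C Θ ν₀`. -/
def CheapDodgersKill : Prop :=
  PacketLemma → (∀ f : 𝕋³ → E³, Torus.IsSmooth f → Torus.IsDivFree f → Torus.HasZeroMean f →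
    CheapDodgerFamily f) → ¬ KolmogorovFloor

/-- Logic: the kill form follows from the roughness theorem. -/
theorem cheapDodgersKill_of_forces (h : FloorWitnessForcesDodgerRoughness) : CheapDodgersKill := by
  intro hP hall hK
  obtain ⟨f, hfs, hfd, hfz, ε₀, C, Θ, ν₀, hw⟩ := kolmogorovFloor_iff_witness.1 hK
  obtain ⟨κ, hκ, hR⟩ := h hP f ε₀ C Θ ν₀ hfs hfd hfz hw
  have hR' : DodgerRoughness f (2 * (κ / 2)) := by
    convert hR using 2
    ring
  exact not_dodgerRoughness_of_cheap (hall f hfs hfd hfz) (half_pos hκ) hR'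

end Summit.AnomalousDissipation.AnomalousDissipation.Cruxes.KolmogorovFloor.Ideate1G2
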